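import Mathlib
import HarnessLib.Audit
import Summits.PneNP.PneNP.Theorems.PstarDirtyMemberSquare

/-!
# The square of a member with a shared literal: second half of «three-block arcs certify nothing» (ROUND-24, O1; memo g27 §74)

FRONTIER range-avoidance ladder, rung F-N3, ROUND 24 (cell `pnp-ideate`, prover-2 memo `g27/O1-PINNING-g27.md` §74; census node
`PstarLocalGateBudgetAssembly.LocalMenuCriterionBoundGateBudget`; restricted-model proof complexity — nothing here bears on `P` versus `NP`).

Companion of `PstarDirtyMemberSquare` for an `N`-type member.  `(K; Γ₁, Γ₂)` a candidate certificate (`G₁` disjoint from `K`), `e ∈ K` with AND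
pair `{σ, p}`: `p` PRIVATE (no other output of `K ∪ G₁`, not read by `Γ₁`), the literal `σ` shared with exactly one SIBLING `o ∈ K ∪ G₁`, `o ≠ e`,
with AND pair `{σ, q}`, `q` private; `σ, p, q` no XOR variables of `K`, not in `C₁`; no monomial of `Γ₂` duplicates `{σ, p}` or `{σ, q}`.
`Ā = Sol(K ∖ e) ∩ {Γ₁ = b₁}` (`InSliceBut`), `A = Ā ∩ Sol(e)` (`InSlice`), and the IDLE set `A₁ = A ∩ {x_σ = 0}` (both `e` and `o` off).

* moves: `sliceBut_update_p` (always), `sliceBut_update_q` / `inSlice_update_q` (when `x_σ = 0`), `sliceBut_update_sigma` (when `x_q = 0`);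
* `slope_p_zero`, `slope_q_zero` (on `A₁`), `slope_sigma_zero` (on `A₁ ∩ {x_p = x_q = 0}`) — (T3) kills the slopes
  `L_v = [v ∈ C₂] + starSum(v)` of `Γ₂` in the free directions;
* `frozen_of_thawed` — a gate partner `u` of `v ∈ {p, q, σ}` thawed in `A₁` is contradictory; so under «every partner frozen on `Ā` or thawed
  in `A₁`» all partners are frozen (and `Γ₂` has no gate `{p, q}`);
* (companion `PstarSharedMemberKill`) `gval_ne_on_sliceBut_shared` — then `L_p ≡ L_q ≡ L_σ ≡ 0` on `Ā` and `Γ₂ ≠ b₂` on ALL of `Ā`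
  (`x_σ = 1`: flip `p`; `x_σ = 0`: set `p := 1`, `q := 0`, flip `σ`) ⇒ (M0) fails at `e`: `not_terminal_of_shared_member`.

USE (all `k`, with `PstarDeadPatterns`): an `N`-member `t_i` with UNPINNED `σ_i` in an arc carrying ≥ 2 further blocks satisfies the hypotheses
for every second reader; with `PstarDirtyMemberSquare` every three-block arc has a member where (M0) fails — «three-block arcs certify nothing»,
hence the folds of a certificate lie in ≤ 2 literal classes per arc (the F₁ bound of g26 §65.4 (ii)).
-/

set_option linter.dupNamespace false -- `Summit.PneNP.PneNP.…`: summit = sub-problem name (D-0017 single-conjunct layout)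

open Finset Literature.Computability.Complexity
open Summit.PneNP.PneNP.Theorems.PstarFibrePolys (bit bit_injective)
open Summit.PneNP.PneNP.Theorems.PstarSALevel (varSet)
open Summit.PneNP.PneNP.Theorems.PstarGapPeeling (eval_pure eval_update_of_not_mem)
open Summit.PneNP.PneNP.Theorems.PstarGapOneAll (gval)
open Summit.PneNP.PneNP.Theorems.PstarGConstraint (bit_gval)
open Summit.PneNP.PneNP.Theorems.PstarCoreBoundTargets (Terminal)
open Summit.PneNP.PneNP.Theorems.PstarMenuLocality (starSum bit_gval_update bit_gval_flip starSum_update_partner)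
open Summit.PneNP.PneNP.Theorems.PstarLiteralPinning (Through InSlice)
open Summit.PneNP.PneNP.Theorems.PstarDirtyMemberSquare (InSliceBut inSlice_iff starSum_update_of_unpaired)

namespace Summit.PneNP.PneNP.Theorems.PstarSharedMemberSquare

variable {n m : ℕ} {I : LocalMap 4 n m} {y : Fin m → Bool} {K : Finset (Fin m)} {w₁ w₂ : Finset (Fin n) × Finset (Fin m) × Bool}
  {e o : Fin m} {σ p q : Fin n}

/-! ## Small facts -/

/-- The AND term of an output with pair `{a, b}` (either orientation). -/
private theorem term_eq {j : Fin m} {a b : Fin n} (h : (I.vars j 2 = a ∧ I.vars j 3 = b) ∨ (I.vars j 2 = b ∧ I.vars j 3 = a))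
    (z : Fin n → Bool) : (z (I.vars j 2) && z (I.vars j 3)) = (z a && z b) := by
  rcases h with ⟨h2, h3⟩ | ⟨h2, h3⟩
  · rw [h2, h3]
  · rw [h2, h3, Bool.and_comm]

/-- A variable off all four slots of an output is not one of its variables. -/
private theorem not_mem_varSet {j : Fin m} {v : Fin n} (h0 : I.vars j 0 ≠ v) (h1 : I.vars j 1 ≠ v) (h23 : ¬ Through I v j) :
    v ∉ varSet I j := by
  intro hmem
  unfold PstarSALevel.varSet at hmem
  obtain ⟨s, -, hs⟩ := mem_image.1 hmem
  fin_cases s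
  · exact h0 hs
  · exact h1 hs
  · exact h23 (Or.inl hs)
  · exact h23 (Or.inr hs)

/-- The partner sum of `v` over monomials none of which (except possibly those we name) passes through `v`… concretely: if only `g₀ ∈ G` passes
through `v`, with partner `w`, then `starSum G v z = bit (z w)`; if none does, it is `0`.  We need the «at most one, with partner off» form: -/
private theorem starSum_eq_zero_of {G : Finset (Fin m)} {v w : Fin n} {g₀ : Fin m} (z : Fin n → Bool)
    (honly : ∀ g ∈ G, Through I v g → g = g₀) (hg₀ : (I.vars g₀ 2 = v ∧ I.vars g₀ 3 = w) ∨ (I.vars g₀ 2 = w ∧ I.vars g₀ 3 = v))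
    (hvw : v ≠ w) (hw : z w = false) : starSum I G v z = 0 := by
  unfold PstarMenuLocality.starSum
  refine sum_eq_zero fun g hg => ?_
  by_cases h2 : I.vars g 2 = v
  · have hgg : g = g₀ := honly g hg (Or.inl h2)
    subst hgg
    rcases hg₀ with ⟨_, h3⟩ | ⟨h2', _⟩
    · have h3v : I.vars g 3 ≠ v := by rw [h3]; exact hvw.symm
      rw [if_pos h2, if_neg h3v, h3, hw]; simp [bit]
    · exact absurd (h2.symm.trans h2') hvw
  · by_cases h3 : I.vars g 3 = v
    · have hgg : g = g₀ := honly g hg (Or.inr h3)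
      subst hgg
      rcases hg₀ with ⟨h2', _⟩ | ⟨h2', _⟩
      · exact absurd h2' h2
      · rw [if_neg h2, if_pos h3, h2', hw]; simp [bit]
    · rw [if_neg h2, if_neg h3, add_zero]

/-! ## The hypotheses -/

/-- **The setting** (`Setup I K w₁ w₂ e o σ p q`): pure instance; `e ∈ K` with AND pair `{σ, p}`; its SIBLING `o ∈ K ∪ G₁`, `o ≠ e`, with AND
pair `{σ, q}`; no third output of `K ∪ G₁` through `σ`; `p` private to `e`, `q` private to `o` (within `K ∪ G₁`); `σ, p, q ∉ C₁` and off the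
XOR slots of `K`; `G₁` disjoint from `K`; no monomial of `Γ₂` with pair `{σ, p}` or `{σ, q}`. -/
structure Setup (I : LocalMap 4 n m) (K : Finset (Fin m)) (w₁ w₂ : Finset (Fin n) × Finset (Fin m) × Bool) (e o : Fin m)
    (σ p q : Fin n) : Prop where
  pure : I.IsPure xorAndPred
  he : e ∈ K
  ho : o ∈ K ∪ w₁.2.1
  hoe : o ≠ e
  hKG : Disjoint K w₁.2.1
  hse : (I.vars e 2 = σ ∧ I.vars e 3 = p) ∨ (I.vars e 2 = p ∧ I.vars e 3 = σ)
  hso : (I.vars o 2 = σ ∧ I.vars o 3 = q) ∨ (I.vars o 2 = q ∧ I.vars o 3 = σ)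
  hσonly : ∀ j ∈ K ∪ w₁.2.1, Through I σ j → j = e ∨ j = o
  hppriv : ∀ j ∈ K ∪ w₁.2.1, j ≠ e → ¬ Through I p j
  hqpriv : ∀ j ∈ K ∪ w₁.2.1, j ≠ o → ¬ Through I q j
  hC₁ : σ ∉ w₁.1 ∧ p ∉ w₁.1 ∧ q ∉ w₁.1
  hX : ∀ j ∈ K, I.vars j 0 ≠ σ ∧ I.vars j 1 ≠ σ ∧ I.vars j 0 ≠ p ∧ I.vars j 1 ≠ p ∧ I.vars j 0 ≠ q ∧ I.vars j 1 ≠ q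
  hG₂ : ∀ g ∈ w₂.2.1, ¬ ((I.vars g 2 = σ ∧ I.vars g 3 = p) ∨ (I.vars g 2 = p ∧ I.vars g 3 = σ)) ∧
    ¬ ((I.vars g 2 = σ ∧ I.vars g 3 = q) ∨ (I.vars g 2 = q ∧ I.vars g 3 = σ))

section Main

variable (H : Setup I K w₁ w₂ e o σ p q)
include H

/-- `σ ≠ p`, `σ ≠ q`, `p ≠ q`. -/
theorem distinct : σ ≠ p ∧ σ ≠ q ∧ p ≠ q := by
  have h1 : I.vars e 2 ≠ I.vars e 3 := fun h => absurd (H.pure.2 e h) (by decide)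
  have h2 : I.vars o 2 ≠ I.vars o 3 := fun h => absurd (H.pure.2 o h) (by decide)
  refine ⟨?_, ?_, ?_⟩
  · rcases H.hse with ⟨a, b⟩ | ⟨a, b⟩
    · rw [← a, ← b]; exact h1
    · rw [← a, ← b]; exact h1.symm
  · rcases H.hso with ⟨a, b⟩ | ⟨a, b⟩
    · rw [← a, ← b]; exact h2
    · rw [← a, ← b]; exact h2.symm
  · intro hpq
    refine H.hppriv o H.ho H.hoe ?_
    rcases H.hso with ⟨_, b⟩ | ⟨a, _⟩
    · exact Or.inr (b.trans hpq.symm)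
    · exact Or.inl (a.trans hpq.symm)

/-! ### Moves inside `Ā` -/

/-- Updating the private `p` stays in `Ā`. -/
theorem sliceBut_update_p {z : Fin n → Bool} (hz : InSliceBut I y K e w₁ z) (b : Bool) : InSliceBut I y K e w₁ (Function.update z p b) := by
  have heG : e ∉ w₁.2.1 := fun h => disjoint_left.1 H.hKG H.he h
  refine ⟨fun j hj hje => ?_, ?_⟩
  · rw [eval_update_of_not_mem I j z (not_mem_varSet (H.hX j hj).2.2.1 (H.hX j hj).2.2.2.1 (H.hppriv j (mem_union_left _ hj) hje)) b]
    exact hz.1 j hj hje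
  · apply bit_injective
    rw [bit_gval_update I H.pure, if_neg H.hC₁.2.1, zero_add, hz.2]
    have : starSum I w₁.2.1 p z = 0 := by
      unfold PstarMenuLocality.starSum
      refine sum_eq_zero fun g hg => ?_
      have hge : g ≠ e := fun h => heG (h ▸ hg)
      have := H.hppriv g (mem_union_right _ hg) hge
      rw [if_neg (fun h => this (Or.inl h)), if_neg (fun h => this (Or.inr h)), add_zero]
    rw [this, mul_zero, add_zero]

/-- With `x_σ = 0`, updating the sibling's private `q` keeps every output of `K` and the reader `Γ₁`. -/
theorem sliceBut_update_q {z : Fin n → Bool} (hzσ : z σ = false) (hz : InSliceBut I y K e w₁ z) (b : Bool) :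
    InSliceBut I y K e w₁ (Function.update z q b) := by
  have hd := distinct H
  refine ⟨fun j hj hje => ?_, ?_⟩
  · by_cases hjo : j = o
    · subst hjo
      rw [← hz.1 j hj hje, eval_pure I H.pure, eval_pure I H.pure, term_eq H.hso, term_eq H.hso, Function.update_of_ne hd.2.1, hzσ,
        Bool.false_and, Bool.false_and, Function.update_of_ne (H.hX j hj).2.2.2.2.1, Function.update_of_ne (H.hX j hj).2.2.2.2.2]
    · rw [eval_update_of_not_mem I j z (not_mem_varSet (H.hX j hj).2.2.2.2.1 (H.hX j hj).2.2.2.2.2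
        (H.hqpriv j (mem_union_left _ hj) hjo)) b]
      exact hz.1 j hj hje
  · apply bit_injective
    rw [bit_gval_update I H.pure, if_neg H.hC₁.2.2, zero_add, hz.2,
      starSum_eq_zero_of z (fun g hg hth => by_contra fun hne => H.hqpriv g (mem_union_right _ hg) hne hth) H.hso.symm hd.2.1.symm hzσ,
      mul_zero, add_zero]

/-- The value of `e`: XOR part plus `x_σ x_p`. -/
theorem eval_e (z : Fin n → Bool) : I.eval z e = xor (xor (z (I.vars e 0)) (z (I.vars e 1))) (z σ && z p) := by
  rw [eval_pure I H.pure, term_eq H.hse]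

/-- With `x_σ = 0` before and after, updating any variable off the XOR slots of `e` keeps `e`'s value. -/
theorem eval_e_update_of_sigma {z : Fin n → Bool} {u : Fin n} (b : Bool) (h0 : I.vars e 0 ≠ u) (h1 : I.vars e 1 ≠ u)
    (hzσ : z σ = false) (hzσ' : Function.update z u b σ = false) : I.eval (Function.update z u b) e = I.eval z e := by
  rw [eval_e H, eval_e H, Function.update_of_ne h0, Function.update_of_ne h1, hzσ, hzσ', Bool.false_and, Bool.false_and]

/-- With `x_σ = 0`, updating `q` keeps `A` (and `A₁`). -/
theorem inSlice_update_q {z : Fin n → Bool} (hzσ : z σ = false) (hz : InSlice I y K w₁ z) (b : Bool) :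
    InSlice I y K w₁ (Function.update z q b) := by
  have hd := distinct H
  have hzb := (inSlice_iff H.he).1 hz
  refine (inSlice_iff H.he).2 ⟨sliceBut_update_q H hzσ hzb.1 b, ?_⟩
  rw [eval_e_update_of_sigma H b (H.hX e H.he).2.2.2.2.1 (H.hX e H.he).2.2.2.2.2 hzσ (by rw [Function.update_of_ne hd.2.1]; exact hzσ)]
  exact hzb.2

/-- With `x_σ = 0`, updating `p` keeps `A` (and `A₁`). -/
theorem inSlice_update_p {z : Fin n → Bool} (hzσ : z σ = false) (hz : InSlice I y K w₁ z) (b : Bool) :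
    InSlice I y K w₁ (Function.update z p b) := by
  have hd := distinct H
  have hzb := (inSlice_iff H.he).1 hz
  refine (inSlice_iff H.he).2 ⟨sliceBut_update_p H hzb.1 b, ?_⟩
  rw [eval_e_update_of_sigma H b (H.hX e H.he).2.2.1 (H.hX e H.he).2.2.2.1 hzσ (by rw [Function.update_of_ne hd.1]; exact hzσ)]
  exact hzb.2

/-- With `x_q = 0`, updating `σ` keeps every output of `K` other than `e`, and the reader `Γ₁`. -/
theorem sliceBut_update_sigma {z : Fin n → Bool} (hzq : z q = false) (hz : InSliceBut I y K e w₁ z) (b : Bool) :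
    InSliceBut I y K e w₁ (Function.update z σ b) := by
  have hd := distinct H
  have heG : e ∉ w₁.2.1 := fun h => disjoint_left.1 H.hKG H.he h
  refine ⟨fun j hj hje => ?_, ?_⟩
  · by_cases hjo : j = o
    · subst hjo
      rw [← hz.1 j hj hje, eval_pure I H.pure, eval_pure I H.pure, term_eq H.hso, term_eq H.hso, Function.update_of_ne hd.2.1.symm, hzq,
        Bool.and_false, Bool.and_false, Function.update_of_ne (H.hX j hj).1, Function.update_of_ne (H.hX j hj).2.1]
    · have hth : ¬ Through I σ j := fun h => by
        rcases H.hσonly j (mem_union_left _ hj) h with h' | h'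
        exacts [hje h', hjo h']
      rw [eval_update_of_not_mem I j z (not_mem_varSet (H.hX j hj).1 (H.hX j hj).2.1 hth) b]
      exact hz.1 j hj hje
  · apply bit_injective
    rw [bit_gval_update I H.pure, if_neg H.hC₁.1, zero_add, hz.2,
      starSum_eq_zero_of z (fun g hg hth => ?_) H.hso hd.2.1 hzq, mul_zero, add_zero]
    rcases H.hσonly g (mem_union_right _ hg) hth with h' | h'
    · exact absurd (h' ▸ hg) heG
    · exact h'

/-! ### The slopes vanish at idle points -/

/-- (T3) at two points of `A` differing in one variable `v`: the slope `L_v` vanishes. -/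
theorem slope_zero_of_pair (hT3 : ∀ z, InSlice I y K w₁ z → gval I w₂.1 w₂.2.1 z ≠ w₂.2.2) {z : Fin n → Bool} {v : Fin n}
    (hz : InSlice I y K w₁ z) (hz' : InSlice I y K w₁ (Function.update z v (!z v))) :
    (if v ∈ w₂.1 then (1 : ZMod 2) else 0) + starSum I w₂.2.1 v z = 0 := by
  have h1 := hT3 z hz
  have h2 := hT3 _ hz'
  have heq : gval I w₂.1 w₂.2.1 (Function.update z v (!z v)) = gval I w₂.1 w₂.2.1 z := by
    revert h1 h2
    cases gval I w₂.1 w₂.2.1 (Function.update z v (!z v)) <;> cases gval I w₂.1 w₂.2.1 z <;> cases w₂.2.2 <;> decide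
  have hflip := bit_gval_flip I H.pure w₂.1 w₂.2.1 z v
  rw [heq] at hflip
  linear_combination -hflip

/-- `L_p ≡ 0` on `A₁`. -/
theorem slope_p_zero (hT3 : ∀ z, InSlice I y K w₁ z → gval I w₂.1 w₂.2.1 z ≠ w₂.2.2) {z : Fin n → Bool} (hz : InSlice I y K w₁ z)
    (hzσ : z σ = false) : (if p ∈ w₂.1 then (1 : ZMod 2) else 0) + starSum I w₂.2.1 p z = 0 :=
  slope_zero_of_pair H hT3 hz (inSlice_update_p H hzσ hz _)

/-- `L_q ≡ 0` on `A₁`. -/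
theorem slope_q_zero (hT3 : ∀ z, InSlice I y K w₁ z → gval I w₂.1 w₂.2.1 z ≠ w₂.2.2) {z : Fin n → Bool} (hz : InSlice I y K w₁ z)
    (hzσ : z σ = false) : (if q ∈ w₂.1 then (1 : ZMod 2) else 0) + starSum I w₂.2.1 q z = 0 :=
  slope_zero_of_pair H hT3 hz (inSlice_update_q H hzσ hz _)

/-- `L_σ = 0` at points of `A` with `x_p = x_q = 0`. -/
theorem slope_sigma_zero (hT3 : ∀ z, InSlice I y K w₁ z → gval I w₂.1 w₂.2.1 z ≠ w₂.2.2) {z : Fin n → Bool} (hz : InSlice I y K w₁ z)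
    (hzp : z p = false) (hzq : z q = false) : (if σ ∈ w₂.1 then (1 : ZMod 2) else 0) + starSum I w₂.2.1 σ z = 0 := by
  have hd := distinct H
  have hzb := (inSlice_iff H.he).1 hz
  refine slope_zero_of_pair H hT3 hz ((inSlice_iff H.he).2 ⟨sliceBut_update_sigma H hzq hzb.1 _, ?_⟩)
  have := hzb.2
  rw [eval_e H] at this ⊢
  rw [Function.update_of_ne (H.hX e H.he).1, Function.update_of_ne (H.hX e H.he).2.1, Function.update_of_ne hd.1.symm, hzp, Bool.and_false]
  rw [hzp, Bool.and_false] at this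
  exact this

/-! ### Gate partners are never thawed in `A₁` -/

/-- A gate partner `u ≠ σ` of `p` is not thawed in `A₁`. -/
theorem not_thawed_p (hT3 : ∀ z, InSlice I y K w₁ z → gval I w₂.1 w₂.2.1 z ≠ w₂.2.2) {g : Fin m} (hg : g ∈ w₂.2.1) {u : Fin n}
    (hgs : (I.vars g 2 = p ∧ I.vars g 3 = u) ∨ (I.vars g 2 = u ∧ I.vars g 3 = p))
    (huniq : ∀ g' ∈ w₂.2.1, g' ≠ g → ¬ ((I.vars g' 2 = p ∧ I.vars g' 3 = u) ∨ (I.vars g' 2 = u ∧ I.vars g' 3 = p)))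
    (huσ : u ≠ σ) {z : Fin n → Bool} (hz : InSlice I y K w₁ z) (hzσ : z σ = false) (hz' : InSlice I y K w₁ (Function.update z u (!z u))) :
    False := by
  have hzσ' : Function.update z u (!z u) σ = false := by rw [Function.update_of_ne huσ.symm]; exact hzσ
  have h0 := slope_p_zero H hT3 hz hzσ
  have h1 := slope_p_zero H hT3 hz' hzσ'
  have hmove := starSum_update_partner I H.pure hg hgs huniq z (!z u)
  have hba : bit (!z u) + bit (z u) = 1 := by cases z u <;> decide
  rw [hmove, hba] at h1
  have h2 : (1 : ZMod 2) = 0 := by linear_combination h1 - h0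
  exact absurd h2 (by decide)

/-- A gate partner `u ≠ σ` of `q` is not thawed in `A₁`. -/
theorem not_thawed_q (hT3 : ∀ z, InSlice I y K w₁ z → gval I w₂.1 w₂.2.1 z ≠ w₂.2.2) {g : Fin m} (hg : g ∈ w₂.2.1) {u : Fin n}
    (hgs : (I.vars g 2 = q ∧ I.vars g 3 = u) ∨ (I.vars g 2 = u ∧ I.vars g 3 = q))
    (huniq : ∀ g' ∈ w₂.2.1, g' ≠ g → ¬ ((I.vars g' 2 = q ∧ I.vars g' 3 = u) ∨ (I.vars g' 2 = u ∧ I.vars g' 3 = q)))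
    (huσ : u ≠ σ) {z : Fin n → Bool} (hz : InSlice I y K w₁ z) (hzσ : z σ = false) (hz' : InSlice I y K w₁ (Function.update z u (!z u))) :
    False := by
  have hzσ' : Function.update z u (!z u) σ = false := by rw [Function.update_of_ne huσ.symm]; exact hzσ
  have h0 := slope_q_zero H hT3 hz hzσ
  have h1 := slope_q_zero H hT3 hz' hzσ'
  have hmove := starSum_update_partner I H.pure hg hgs huniq z (!z u)
  have hba : bit (!z u) + bit (z u) = 1 := by cases z u <;> decide
  rw [hmove, hba] at h1
  have h2 : (1 : ZMod 2) = 0 := by linear_combination h1 - h0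
  exact absurd h2 (by decide)

/-- A gate partner `u ∉ {σ, p, q}` of `σ` is not thawed in `A₁` (normalise `x_p = x_q = 0` first). -/
theorem not_thawed_sigma (hT3 : ∀ z, InSlice I y K w₁ z → gval I w₂.1 w₂.2.1 z ≠ w₂.2.2) {g : Fin m} (hg : g ∈ w₂.2.1) {u : Fin n}
    (hgs : (I.vars g 2 = σ ∧ I.vars g 3 = u) ∨ (I.vars g 2 = u ∧ I.vars g 3 = σ))
    (huniq : ∀ g' ∈ w₂.2.1, g' ≠ g → ¬ ((I.vars g' 2 = σ ∧ I.vars g' 3 = u) ∨ (I.vars g' 2 = u ∧ I.vars g' 3 = σ)))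
    (hup : u ≠ p) (huq : u ≠ q) (huσ : u ≠ σ) {z : Fin n → Bool} (hz : InSlice I y K w₁ z) (hzσ : z σ = false)
    (hz' : InSlice I y K w₁ (Function.update z u (!z u))) : False := by
  have hd := distinct H
  have hzσ' : Function.update z u (!z u) σ = false := by rw [Function.update_of_ne huσ.symm]; exact hzσ
  -- normalise `p, q := 0` at both points (free moves in `A₁`, commuting with the `u`-flip)
  set z₀ := Function.update (Function.update z p false) q false with hz₀
  have hzpσ : Function.update z p false σ = false := by rw [Function.update_of_ne hd.1]; exact hzσ
  have hz₀A : InSlice I y K w₁ z₀ := inSlice_update_q H hzpσ (inSlice_update_p H hzσ hz false) false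
  have hzpσ' : Function.update (Function.update z u (!z u)) p false σ = false := by rw [Function.update_of_ne hd.1]; exact hzσ'
  have hz₀' : Function.update z₀ u (!z₀ u) = Function.update (Function.update (Function.update z u (!z u)) p false) q false := by
    rw [hz₀, Function.update_of_ne huq, Function.update_of_ne hup, Function.update_comm huq.symm, Function.update_comm hup.symm]
  have hz₀'A : InSlice I y K w₁ (Function.update z₀ u (!z₀ u)) := by
    rw [hz₀']
    exact inSlice_update_q H hzpσ' (inSlice_update_p H hzσ' hz' false) false
  have hp0 : z₀ p = false := by rw [hz₀, Function.update_of_ne hd.2.2, Function.update_self]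
  have hq0 : z₀ q = false := by rw [hz₀, Function.update_self]
  have hp0' : Function.update z₀ u (!z₀ u) p = false := by rw [Function.update_of_ne hup.symm]; exact hp0
  have hq0' : Function.update z₀ u (!z₀ u) q = false := by rw [Function.update_of_ne huq.symm]; exact hq0
  have h0 := slope_sigma_zero H hT3 hz₀A hp0 hq0
  have h1 := slope_sigma_zero H hT3 hz₀'A hp0' hq0'
  have hmove := starSum_update_partner I H.pure hg hgs huniq z₀ (!z₀ u)
  have hba : bit (!z₀ u) + bit (z₀ u) = 1 := by cases z₀ u <;> decide
  rw [hmove, hba] at h1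
  have h2 : (1 : ZMod 2) = 0 := by linear_combination h1 - h0
  exact absurd h2 (by decide)

end Main

end Summit.PneNP.PneNP.Theorems.PstarSharedMemberSquare
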